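import Summits.QuantumFields.YangMills.Theorems.BalabanUVNodesK0Stub1Letters10OnA1OfFlatSocket
import Summits.QuantumFields.YangMills.Theorems.BalabanUVNodesN07MultiplierLetterNearTop
import HarnessLib

/-!
# N07 [B11] ∕ K0⁷ stub 1 chart lane — **THE OUTWARD MEET EDITION, FILE G: THE A₁ LINE OF (165) ON A WINDOW OF NEAR-TOP CELLS** (n07-e `OUTWARD-MEET-EDITION-SPEC.md` (E2) — the
# `Letters10On (π □) η t₁ A₁` input of HCHART-MEET at an outward datum): k0-s1-w1's `K0Stub1Letters10OnA1.letters10On_A1_of_bodyAt_adm22 ∕ exists_letters10On_A1_closed_of_adm22_T4`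
# and `K0Stub1Letters10OnA1OfFlatSocket.exists_letters10On_A1_of_flatSocket_T4` ask the window over the TOP domain (`D.InOm (K−n) x`: weights `= 1` in rows 1–3, k0-s1-w4's
# multiplier letter at the top layer); at print's (150) family `D″` the outward print box carries cells of level `K−n−1`.  This file re-derives the three theorems with
# `D.InOm (K−n−1) x` on the window and the threshold multiplied by `L⁸` (weights `≥ L^{−m}` in rows 1–3, FILE F's near-top multiplier letter and `∂*∂`-row), every other
# binder VERBATIM

Cell `pub-ymgap`, width seat `pub-ymgap-dag-n07-w4` g5 (S6 HEAD; (E2) OFFER ∕ conditional CLAIM-3, cell bus I.41203).  `--kind proof --supports stmt-QuantumFields-20541 --as helper`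
(K0⁷: editions of k0-s1-w1∕w4's 20541-keyed files — n07-e's word I.41213, KEY MAP content rule); count-neutral; def-free.  [15] = [Balaban1985Variational]; [B6] = [Balaban1984PropagatorsII]; [6] = [Balaban1985RegularSpaces].

WHAT IS PROVED (sorry-free; def-free; axioms standard): ★★ `letters10On_A1_of_bodyAt_adm22_nearTop` (k0-s1-w1 §1 one level down: rows 1–2 by p604735 with `w₁ ≥ L⁻¹`,
`w₂ ≥ L⁻²`; row 3 by FILE F with `θ = L⁻³`, `B_𝔐 = (L⁴B₀B₃ + L⁴ + 1)LC_G`); ★★★ `exists_letters10On_A1_closed_of_adm22_T4_nearTop`; ★★★ `exists_letters10On_A1_of_flatSocket_T4_nearTop`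
(p645691 with the near-top window and the `L⁸` threshold).  HONEST SCOPE: count-neutral re-derivations with a weaker window hypothesis (parents untouched); `hWq`, (128), the
sizes, the slice, the ♭ socket's inputs remain HYPOTHESES; nothing of [15]∕[B6] analysis asserted; no stub ∕ K-item closed; N07 NOT discharged; counts unmoved (28∕28 · 5∕27); the route
closes the conditional finite-𝕋⁴ rung `BalabanLadder.UV` ONLY; the YM mass gap (Clay) is NOT proved by any of this.  No `sorry` ∕ `def` ∕ `instance` ∕ `notation`.
References: [15] (10) p. 279, (128) p. 297, (131)–(133) p. 298, (150)–(153) p. 301, (158)–(159) pp. 302–303, (165)–(167) p. 304; [B6] (2.1)–(2.4) p. 224, (2.19) p. 226,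
Prop. 2.2 (2.47) p. 231, Cor. 2.8 p. 249; [6] (1.2) p. 76, (1.140) p. 100.
-/

set_option autoImplicit false
noncomputable section
open scoped BigOperators Matrix Matrix.Norms.L2Operator InnerProductSpace RealInnerProductSpace ContDiff

namespace Summit.QuantumFields.YangMills.BalabanUVNodes.N07Letters10OnA1NearTop

open Literature.MathematicalPhysics.QuantumFieldTheory.Balaban1983to89
open Literature.MathematicalPhysics.QuantumFieldTheory.Balaban1983to89.Node00
open Literature.MathematicalPhysics.QuantumFieldTheory.BalabanImbrieJaffe1984to88.BIJ85AxialPropagator411 (BondSpace)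
open Literature.MathematicalPhysics.QuantumFieldTheory.BalabanImbrieJaffe1984to88.BIJ85Sigma422Eta (eta_inv eta_pos)
open T4Continuum (T4Family)
open T4AdjointCovarianceUnitary (lieSU mem_lieSU_iff)
open B9AdOrthogonal (herm0)
open B15DeterminingSets (bondsOf DetSet avgFamily)
open B6SectADomainsV1 (Domains)
open B6SectAOperatorsV1 (BondIdx BondIdxSpace QE QsE RE dsE dcE dcsE)
open B6SectAVectorModelV1 (deltaAE GE EE)
open B6SectA (hOp)
open Summit.QuantumFields.YangMills.Theorems.FlatCubeOpsText (Adm22)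
open Summit.QuantumFields.YangMills.Theorems.K0FlatCubeOpsTextP (IsLevWeight flatH IsFlatGW GtSupLetterG BodyAt levWeight_nonneg)
open Summit.QuantumFields.YangMills.Theorems.K0FlatPortBodyP (body_of_adm22_T4)
open Summit.QuantumFields.YangMills.Theorems.Prop8Chart (expCfg)
open Summit.QuantumFields.YangMills.Theorems.Prop8ChartDoubleBar (chartLogFlat)
open Summit.QuantumFields.YangMills.Theorems.K0Stub1MultiplierLetterP (B₀_nonneg_of_hSupLetterG)
open Summit.QuantumFields.YangMills.Theorems.K0Stub1MultiplierLetterAtRecord (gRowsBand_of_adm22_T4)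
open Summit.QuantumFields.YangMills.Theorems.K0Stub1Letter165GtLetterAtRecord (letter165_rows_of_critical128_bodyAt)
open Summit.QuantumFields.YangMills.Theorems.K0Stub1H128OfFlatSocket (h128_of_socket127_flat re_trace_pairing_rescaled_current_traceless inv_I_eta_smul_mem_herm0)
open Summit.QuantumFields.YangMills.Theorems.K0Stub1FlatCurrentA1LineRows (norm_inv_I_eta_smul)
open Summit.QuantumFields.YangMills.Theorems.K0Stub1FlatCurrentA1LineRowsAtRecord (exists_sectF_W_flatScaled_atRecord_socket_A1rows)
open Summit.QuantumFields.YangMills.Theorems.K0Stub1Letters10OnA1OfFlatSocket (hermLetter_rows_lt)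
open Summit.QuantumFields.YangMills.BalabanUVNodes.N07HalvingStepTopOfLocalLetters (Letters10On)
open Summit.QuantumFields.YangMills.BalabanUVNodes.N07Letters10OfRealRows (letters10On_of_realRows)
open Summit.QuantumFields.YangMills.BalabanUVNodes.N07Letters10OfWeightedRowsNearTop (pow_inv_le_levWeightP_of_inOm)
open Summit.QuantumFields.YangMills.BalabanUVNodes.N07MultiplierLetterNearTop (multiplierLetter_matrix_of_bodyAt_adm22_nearTop curlCurl_row_of_critical128_mat_lb)

variable {N : ℕ} [NeZero N]

section Body
/-- ★★ **THE A₁ LINE OF (165) AT A FAMILY WITH THE P2 BODY, WINDOW OF NEAR-TOP CELLS** — k0-s1-w1's `letters10On_A1_of_bodyAt_adm22` with `hY : ∀ x ∈ Y, D.InOm (k − 1) x` (`1 ≤ k`)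
and the threshold `t > L⁸·max{B₀, 1 + (B₀B₃ + 1)·L·C_G}·(C₄·ρ²)`, every other binder VERBATIM: the (152) weights of a bond based in `Y` are `≥ L^{−m}` (one level below the top at
worst), so rows 1–2 of p604735 cost `L`, `L²`, and row 3 (p610743 with `θ = L⁻³ ≤ w₃` on the window, FILE F) costs `L³ + (L⁴B₀B₃ + L⁴ + 1)·L·C_G ≤ L⁸·(1 + (B₀B₃ + 1)·L·C_G)`.
[cite: Balaban1985Variational, (10) p.279, (150)–(153) p.301, (158)–(159) pp.302–303, (165)–(167) p.304; Balaban1984PropagatorsII, Prop. 2.2 (2.47) p.231, (2.35) p.228] -/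
theorem letters10On_A1_of_bodyAt_adm22_nearTop (F : T4Family) (K k : ℕ) (D : Domains (F.P K)) (hDk : D.k = k) (hk1 : 1 ≤ k)
    {w : ℕ → PBond (F.P K) 0 → ℝ} (hw : IsLevWeight (F.P K) k D w) {B₀ δ₀ B₃ : ℝ} (hBody : BodyAt (F.P K) k D w B₀ δ₀ B₃) (hδ₀ : 0 ≤ δ₀) (hB₃ : 0 ≤ B₃)
    {R M : ℕ} (hAdm : Adm22 D R M) (hRM : 2 * (F.P K).L ≤ R * M)
    {a : BondIdx D → ℝ} (ha : ∀ i, 0 < a i) {G : (PBond (F.P K) 0 → ℝ) →ₗ[ℝ] (PBond (F.P K) 0 → ℝ)} (hGW : IsFlatGW (F.P K) k D ha G)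
    {CG : ℝ} (hCG : 0 ≤ CG) (hGsup : GtSupLetterG (F.P K) k w G CG)
    (hband : ∀ c : BondIdx D, a c ≤ (((F.P K).L : ℝ) ^ k) ^ ((F.P K).d - 1) * ((F.P K).L : ℝ) ^ (c.1.1 : ℕ))
    {instDE : DecidableEq (PBond (F.P K) 0)} {instDB : DecidableEq (BondIdx D)}
    {DV GV MV : (PBond (F.P K) 0 → Matrix (Fin N) (Fin N) ℂ) →ₗ[ℂ] (PBond (F.P K) 0 → Matrix (Fin N) (Fin N) ℂ)}
    {QV : (PBond (F.P K) 0 → Matrix (Fin N) (Fin N) ℂ) →ₗ[ℂ] (BondIdx D → Matrix (Fin N) (Fin N) ℂ)}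
    {HV : (BondIdx D → Matrix (Fin N) (Fin N) ℂ) →ₗ[ℂ] (PBond (F.P K) 0 → Matrix (Fin N) (Fin N) ℂ)}
    (hDV : ∀ (A : PBond (F.P K) 0 → Matrix (Fin N) (Fin N) ℂ) (b : PBond (F.P K) 0),
      DV A b = ∑ j, ((WithLp.ofLp (deltaAE D ((F.P K).L ^ k : ℝ) (fun _ => (1 : ℝ)) (WithLp.toLp 2 (Pi.single j 1))) b : ℝ) : ℂ) • A j)
    (hGV : ∀ (A : PBond (F.P K) 0 → Matrix (Fin N) (Fin N) ℂ) (b : PBond (F.P K) 0),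
      GV A b = ∑ j, ((WithLp.ofLp ((GE D (c := ((F.P K).L : ℝ) ^ k) (pow_ne_zero _ (Nat.cast_ne_zero.2 (F.P K).L_pos.ne')) (w := fun _ => (1 : ℝ)) (fun _ => one_pos)
        - hOp (GE D (c := ((F.P K).L : ℝ) ^ k) (pow_ne_zero _ (Nat.cast_ne_zero.2 (F.P K).L_pos.ne')) (w := fun _ => (1 : ℝ)) (fun _ => one_pos)) (QsE D)
            (EE D (c := ((F.P K).L : ℝ) ^ k) (pow_ne_zero _ (Nat.cast_ne_zero.2 (F.P K).L_pos.ne')) (w := fun _ => (1 : ℝ)) (fun _ => one_pos))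
          ∘ₗ QE D ∘ₗ GE D (c := ((F.P K).L : ℝ) ^ k) (pow_ne_zero _ (Nat.cast_ne_zero.2 (F.P K).L_pos.ne')) (w := fun _ => (1 : ℝ)) (fun _ => one_pos))
        (WithLp.toLp 2 (Pi.single j 1))) b : ℝ) : ℂ) • A j)
    (hQV : ∀ (A : PBond (F.P K) 0 → Matrix (Fin N) (Fin N) ℂ) (t : BondIdx D),
      QV A t = ∑ j, ((WithLp.ofLp (QE D (WithLp.toLp 2 (Pi.single j 1))) t : ℝ) : ℂ) • A j)
    (hHV : ∀ (B : BondIdx D → Matrix (Fin N) (Fin N) ℂ) (b : PBond (F.P K) 0),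
      HV B b = ∑ t, ((WithLp.ofLp (hOp (GE D (c := ((F.P K).L : ℝ) ^ k) (pow_ne_zero _ (Nat.cast_ne_zero.2 (F.P K).L_pos.ne')) (w := fun _ => (1 : ℝ)) (fun _ => one_pos))
        (QsE D) (EE D (c := ((F.P K).L : ℝ) ^ k) (pow_ne_zero _ (Nat.cast_ne_zero.2 (F.P K).L_pos.ne')) (w := fun _ => (1 : ℝ)) (fun _ => one_pos))
        (WithLp.toLp 2 (Pi.single t 1))) b : ℝ) : ℂ) • B t)
    (hMV : ∀ (A : PBond (F.P K) 0 → Matrix (Fin N) (Fin N) ℂ) (b : PBond (F.P K) 0),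
      MV A b = ∑ j, ((WithLp.ofLp ((QsE D
          ∘ₗ EE D (c := ((F.P K).L : ℝ) ^ k) (pow_ne_zero _ (Nat.cast_ne_zero.2 (F.P K).L_pos.ne')) (w := fun _ => (1 : ℝ)) (fun _ => one_pos)
          ∘ₗ QE D ∘ₗ GE D (c := ((F.P K).L : ℝ) ^ k) (pow_ne_zero _ (Nat.cast_ne_zero.2 (F.P K).L_pos.ne')) (w := fun _ => (1 : ℝ)) (fun _ => one_pos))
        (WithLp.toLp 2 (Pi.single j 1))) b : ℝ) : ℂ) • A j)
    (W : (PBond (F.P K) 0 → Matrix (Fin N) (Fin N) ℂ) → (PBond (F.P K) 0 → Matrix (Fin N) (Fin N) ℂ)) {C₄ a₃ ρ : ℝ}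
    (hWq : ∀ (Y : PBond (F.P K) 0 → Matrix (Fin N) (Fin N) ℂ) (r : ℝ), r < a₃ → (∀ b, w 1 b * ‖Y b‖ ≤ r) →
      (∀ (b : PBond (F.P K) 0) (ν : Fin 4), w 2 b * (F.L : ℝ) ^ k * ‖Y ⟨b.src.shift ν, b.dir⟩ - Y b‖ ≤ r) →
        ∀ b, w 3 b * ‖W Y b‖ ≤ C₄ * r ^ 2)
    (X : PBond (F.P K) 0 → lieSU (Fin N))
    (hWA : ∀ j, (W (fun b => ((X b : lieSU (Fin N)) : Matrix (Fin N) (Fin N) ℂ)) j)ᴴ = -(W (fun b => ((X b : lieSU (Fin N)) : Matrix (Fin N) (Fin N) ℂ)) j))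
    (hWtr : ∀ j, (W (fun b => ((X b : lieSU (Fin N)) : Matrix (Fin N) (Fin N) ℂ)) j).trace = 0)
    (h128 : ∀ δ : PBond (F.P K) 0 → lieSU (Fin N), QV (fun j => ((δ j : lieSU (Fin N)) : Matrix (Fin N) (Fin N) ℂ)) = 0 →
      ∑ j, (((δ j : lieSU (Fin N)) : Matrix (Fin N) (Fin N) ℂ)ᴴ *
        (DV (fun b => ((X b : lieSU (Fin N)) : Matrix (Fin N) (Fin N) ℂ)) j + W (fun b => ((X b : lieSU (Fin N)) : Matrix (Fin N) (Fin N) ℂ)) j)).trace.re = 0)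
    (hρ : ρ < a₃) (h1 : ∀ b, w 1 b * ‖((X b : lieSU (Fin N)) : Matrix (Fin N) (Fin N) ℂ)‖ ≤ ρ)
    (h2 : ∀ (b : PBond (F.P K) 0) (ν : Fin 4),
      w 2 b * (F.L : ℝ) ^ k * ‖((X ⟨b.src.shift ν, b.dir⟩ : lieSU (Fin N)) : Matrix (Fin N) (Fin N) ℂ) - ((X b : lieSU (Fin N)) : Matrix (Fin N) (Fin N) ℂ)‖ ≤ ρ)
    (hslice : ∀ φ : Matrix (Fin N) (Fin N) ℂ →L[ℂ] ℂ,
      RE D (((F.P K).L : ℝ) ^ k) (dsE (((F.P K).L : ℝ) ^ k) (WithLp.toLp 2 (fun b => (φ ((X b : lieSU (Fin N)) : Matrix (Fin N) (Fin N) ℂ)).re))) = 0)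
    {Y : Set (Site (F.P K) 0)} (hY : ∀ x ∈ Y, D.InOm (k - 1) x) {t : ℝ}
    (ht : ((F.P K).L : ℝ) ^ 8 * (max B₀ (1 + (B₀ * B₃ + 1) * ((F.P K).L : ℝ) * CG) * (C₄ * ρ ^ 2)) < t) :
    Letters10On Y ((F.P K).eta k) t ((fun b => ((X b : lieSU (Fin N)) : Matrix (Fin N) (Fin N) ℂ)) - HV (QV fun b => ((X b : lieSU (Fin N)) : Matrix (Fin N) (Fin N) ℂ))) := by
  have hw0 : ∀ m b, 0 ≤ w m b := fun m b => levWeight_nonneg hw m b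
  have hL0 : (0 : ℝ) < ((F.P K).L : ℝ) := Nat.cast_pos.2 (F.P K).L_pos
  have hL1 : (1 : ℝ) ≤ ((F.P K).L : ℝ) := by exact_mod_cast (F.P K).L_pos
  have hB₀ : 0 ≤ B₀ := by
    obtain ⟨_, _, _, _, hHsup, _⟩ := hBody
    exact B₀_nonneg_of_hSupLetterG hHsup
  -- rows 1–2 (p604735, the port's `G̃`-letters discharged on `BodyAt`)
  obtain ⟨hrow1, hrow2, -⟩ := letter165_rows_of_critical128_bodyAt F K k D hw0 hBody hDV hGV hQV hHV W hWq X hWA hWtr h128 hρ h1 h2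
  -- row 3 (p610743 with a LOWER BOUND `L⁻³ ≤ w₃` on the window and FILE F's near-top multiplier letter)
  obtain ⟨Mop, hMop⟩ : ∃ Mop : (PBond (F.P K) 0 → ℝ) →ₗ[ℝ] (PBond (F.P K) 0 → ℝ), ∀ (g : PBond (F.P K) 0 → ℝ) (b : PBond (F.P K) 0),
      Mop g b = QsE D (EE D (c := ((F.P K).L : ℝ) ^ k) (pow_ne_zero _ (Nat.cast_ne_zero.2 (F.P K).L_pos.ne')) (w := fun _ => (1 : ℝ))
        (fun _ => one_pos) (QE D (GE D (c := ((F.P K).L : ℝ) ^ k) (pow_ne_zero _ (Nat.cast_ne_zero.2 (F.P K).L_pos.ne')) (w := fun _ => (1 : ℝ))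
        (fun _ => one_pos) (WithLp.toLp 2 g)))) b :=
    ⟨(WithLp.linearEquiv 2 ℝ (PBond (F.P K) 0 → ℝ)).toLinearMap ∘ₗ
        (QsE D ∘ₗ EE D (c := ((F.P K).L : ℝ) ^ k) (pow_ne_zero _ (Nat.cast_ne_zero.2 (F.P K).L_pos.ne')) (w := fun _ => (1 : ℝ)) (fun _ => one_pos) ∘ₗ
          QE D ∘ₗ GE D (c := ((F.P K).L : ℝ) ^ k) (pow_ne_zero _ (Nat.cast_ne_zero.2 (F.P K).L_pos.ne')) (w := fun _ => (1 : ℝ)) (fun _ => one_pos)) ∘ₗ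
        (WithLp.linearEquiv 2 ℝ (PBond (F.P K) 0 → ℝ)).symm.toLinearMap,
      fun _ _ => rfl⟩
  have hMmat : ∀ (g : PBond (F.P K) 0 → Matrix (Fin N) (Fin N) ℂ) (β : ℝ), 0 ≤ β → (∀ b, w 3 b * ‖g b‖ ≤ β) →
      ∀ b ∈ {b : PBond (F.P K) 0 | b.src ∈ Y}, ‖MV g b‖ ≤
        ((((F.P K).L : ℝ) ^ 4 * (B₀ * B₃) + ((((F.P K).L : ℝ) ^ (F.P K).d) + 1)) * ((F.P K).L : ℝ) * CG) * β := by
    intro g β hβ hg b' hb'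
    have hℳ : ∀ b, MV g b = ∑ b'', Mop (Pi.single b'' 1) b • g b'' := fun b => by
      rw [hMV]
      refine Finset.sum_congr rfl fun j _ => ?_
      rw [Complex.coe_smul, hMop]
      rfl
    exact multiplierLetter_matrix_of_bodyAt_adm22_nearTop hDk hk1 hw hBody hδ₀ hB₃ hAdm hRM ha hGW hCG hGsup hband Mop hMop hY hβ hg hℳ b' hb'
  have hθ : (0 : ℝ) < ((((F.P K).L : ℝ) ^ 1)⁻¹) ^ 3 := by positivity
  have hS : ∀ b ∈ {b : PBond (F.P K) 0 | b.src ∈ Y}, ((((F.P K).L : ℝ) ^ 1)⁻¹) ^ 3 ≤ w 3 b := fun b hb => pow_inv_le_levWeightP_of_inOm hw hk1 (hY _ hb) 3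
  have hrow3 := curlCurl_row_of_critical128_mat_lb F K k w hw0 D hDV hGV hQV hHV hMV W hWq X hWA hWtr h128 hρ h1 h2 hslice
    (S := {b : PBond (F.P K) 0 | b.src ∈ Y}) hθ hS hMmat
  -- the common threshold `T = L⁸·max{B₀, 1 + (B₀B₃+1)LC_G}·(C₄ρ²)` dominates the three near-top row bounds
  have hC : 0 ≤ C₄ * ρ ^ 2 :=
    (mul_nonneg (hw0 3 ⟨fun _ => 0, ⟨0, (F.P K).hd⟩⟩) (norm_nonneg _)).trans
      (hWq (fun b => ((X b : lieSU (Fin N)) : Matrix (Fin N) (Fin N) ℂ)) ρ hρ h1 h2 _)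
  set T : ℝ := ((F.P K).L : ℝ) ^ 8 * (max B₀ (1 + (B₀ * B₃ + 1) * ((F.P K).L : ℝ) * CG) * (C₄ * ρ ^ 2)) with hT
  have hMC : B₀ * (C₄ * ρ ^ 2) ≤ max B₀ (1 + (B₀ * B₃ + 1) * ((F.P K).L : ℝ) * CG) * (C₄ * ρ ^ 2) := mul_le_mul_of_nonneg_right (le_max_left _ _) hC
  have hMC0 : 0 ≤ max B₀ (1 + (B₀ * B₃ + 1) * ((F.P K).L : ℝ) * CG) * (C₄ * ρ ^ 2) := (mul_nonneg hB₀ hC).trans hMC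
  have hL8 : ((F.P K).L : ℝ) ≤ ((F.P K).L : ℝ) ^ 8 := by
    calc ((F.P K).L : ℝ) = ((F.P K).L : ℝ) ^ 1 := (pow_one _).symm
      _ ≤ ((F.P K).L : ℝ) ^ 8 := pow_le_pow_right₀ hL1 (by norm_num)
  have hL28 : ((F.P K).L : ℝ) ^ 2 ≤ ((F.P K).L : ℝ) ^ 8 := pow_le_pow_right₀ hL1 (by norm_num)
  have hq1 : ((F.P K).L : ℝ) * (B₀ * (C₄ * ρ ^ 2)) ≤ T := by
    rw [hT]; exact mul_le_mul hL8 hMC (mul_nonneg hB₀ hC) (by positivity)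
  have hq2 : ((F.P K).L : ℝ) ^ 2 * (B₀ * (C₄ * ρ ^ 2)) ≤ T := by
    rw [hT]; exact mul_le_mul hL28 hMC (mul_nonneg hB₀ hC) (by positivity)
  have hq3 : ((((((F.P K).L : ℝ) ^ 1)⁻¹) ^ 3)⁻¹ + (((F.P K).L : ℝ) ^ 4 * (B₀ * B₃) + ((((F.P K).L : ℝ) ^ (F.P K).d) + 1)) * ((F.P K).L : ℝ) * CG) *
      (C₄ * ρ ^ 2) ≤ T := by
    have hd : (F.P K).d = 4 := T4Family.P_d F K
    rw [hd, pow_one, inv_pow, inv_inv, hT]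
    have hBB : 0 ≤ B₀ * B₃ := mul_nonneg hB₀ hB₃
    have hL2 : (2 : ℝ) ≤ ((F.P K).L : ℝ) := by have := (F.P K).hL.2; exact_mod_cast this
    have hL4 : (16 : ℝ) ≤ ((F.P K).L : ℝ) ^ 4 := by nlinarith [pow_le_pow_left₀ (by norm_num : (0:ℝ) ≤ 2) hL2 4]
    have hkey : ((F.P K).L : ℝ) ^ 3 + (((F.P K).L : ℝ) ^ 4 * (B₀ * B₃) + (((F.P K).L : ℝ) ^ 4 + 1)) * ((F.P K).L : ℝ) * CG ≤
        ((F.P K).L : ℝ) ^ 8 * (1 + (B₀ * B₃ + 1) * ((F.P K).L : ℝ) * CG) := by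
      have h3 : ((F.P K).L : ℝ) ^ 3 ≤ ((F.P K).L : ℝ) ^ 8 := pow_le_pow_right₀ hL1 (by norm_num)
      have h48 : ((F.P K).L : ℝ) ^ 4 ≤ ((F.P K).L : ℝ) ^ 8 := pow_le_pow_right₀ hL1 (by norm_num)
      have h8 : ((F.P K).L : ℝ) ^ 8 = ((F.P K).L : ℝ) ^ 4 * ((F.P K).L : ℝ) ^ 4 := by rw [← pow_add]
      have hmid : ((F.P K).L : ℝ) ^ 4 * (B₀ * B₃) + (((F.P K).L : ℝ) ^ 4 + 1) ≤ ((F.P K).L : ℝ) ^ 8 * (B₀ * B₃ + 1) := by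
        rw [mul_add, mul_one]
        refine add_le_add (mul_le_mul_of_nonneg_right h48 hBB) ?_
        rw [h8]; nlinarith
      have hLC : 0 ≤ ((F.P K).L : ℝ) * CG := by positivity
      calc ((F.P K).L : ℝ) ^ 3 + (((F.P K).L : ℝ) ^ 4 * (B₀ * B₃) + (((F.P K).L : ℝ) ^ 4 + 1)) * ((F.P K).L : ℝ) * CG
          ≤ ((F.P K).L : ℝ) ^ 8 + (((F.P K).L : ℝ) ^ 8 * (B₀ * B₃ + 1)) * ((F.P K).L : ℝ) * CG := by
            have := mul_le_mul_of_nonneg_right hmid hLC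
            nlinarith [this]
        _ = ((F.P K).L : ℝ) ^ 8 * (1 + (B₀ * B₃ + 1) * ((F.P K).L : ℝ) * CG) := by ring
    calc (((F.P K).L : ℝ) ^ 3 + (((F.P K).L : ℝ) ^ 4 * (B₀ * B₃) + (((F.P K).L : ℝ) ^ 4 + 1)) * ((F.P K).L : ℝ) * CG) * (C₄ * ρ ^ 2)
        ≤ (((F.P K).L : ℝ) ^ 8 * (1 + (B₀ * B₃ + 1) * ((F.P K).L : ℝ) * CG)) * (C₄ * ρ ^ 2) := mul_le_mul_of_nonneg_right hkey hC
      _ ≤ ((F.P K).L : ℝ) ^ 8 * (max B₀ (1 + (B₀ * B₃ + 1) * ((F.P K).L : ℝ) * CG) * (C₄ * ρ ^ 2)) := by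
          rw [mul_assoc]
          exact mul_le_mul_of_nonneg_left (mul_le_mul_of_nonneg_right (le_max_right _ _) hC) (by positivity)
  have hq : 0 ≤ T := by rw [hT]; positivity
  -- strip a weight `w ≥ L⁻ᵐ` from a weighted row
  have strip : ∀ {wt x B : ℝ} (m : ℕ), ((((F.P K).L : ℝ) ^ 1)⁻¹) ^ m ≤ wt → 0 ≤ x → wt * x ≤ B → x ≤ ((F.P K).L : ℝ) ^ m * B := by
    intro wt x B m hwt hx hle
    have hLm : (0 : ℝ) < ((F.P K).L : ℝ) ^ m := by positivity
    have hlow : (((F.P K).L : ℝ) ^ m)⁻¹ * x ≤ wt * x := by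
      rw [pow_one, inv_pow] at hwt
      exact mul_le_mul_of_nonneg_right hwt hx
    have := hlow.trans hle
    rwa [inv_mul_le_iff₀ hLm] at this
  refine letters10On_of_realRows (eta_pos (F.P K) k) hq ht fun f u r hf b hb => ⟨?_, fun κ => ?_, ?_⟩
  · -- row 1: `|Re φ(A₁ b)| ≤ ‖A₁ b‖ ≤ L·B₀C₄ρ²` (`w₁ ≥ L⁻¹`)
    refine (hf _).trans ?_
    have h := strip 1 (pow_inv_le_levWeightP_of_inOm hw hk1 (hY _ hb) 1) (norm_nonneg _) (hrow1 b)
    rw [pow_one] at h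
    exact h.trans hq1
  · -- row 2: `η_k⁻¹·|Re φ(A₁ b′) − Re φ(A₁ b)| ≤ Lᵏ‖A₁ b′ − A₁ b‖ ≤ L²·B₀C₄ρ²` (`w₂ ≥ L⁻²`)
    rw [eta_inv]
    have hrow2' : w 2 b * ((F.L : ℝ) ^ k * ‖((fun b => ((X b : lieSU (Fin N)) : Matrix (Fin N) (Fin N) ℂ)) - HV (QV fun b => ((X b : lieSU (Fin N)) : Matrix (Fin N) (Fin N) ℂ))) ⟨b.src.shift κ, b.dir⟩ - ((fun b => ((X b : lieSU (Fin N)) : Matrix (Fin N) (Fin N) ℂ)) - HV (QV fun b => ((X b : lieSU (Fin N)) : Matrix (Fin N) (Fin N) ℂ))) b‖) ≤ B₀ * (C₄ * ρ ^ 2) := by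
      have h := hrow2 b κ; rwa [mul_assoc] at h
    have h := strip 2 (pow_inv_le_levWeightP_of_inOm hw hk1 (hY _ hb) 2) (by positivity) hrow2'
    refine le_trans ?_ (h.trans hq2)
    have hdiff : r * (u * f (((fun b => ((X b : lieSU (Fin N)) : Matrix (Fin N) (Fin N) ℂ)) - HV (QV fun b => ((X b : lieSU (Fin N)) : Matrix (Fin N) (Fin N) ℂ))) ⟨b.src.shift κ, b.dir⟩)).re - r * (u * f (((fun b => ((X b : lieSU (Fin N)) : Matrix (Fin N) (Fin N) ℂ)) - HV (QV fun b => ((X b : lieSU (Fin N)) : Matrix (Fin N) (Fin N) ℂ))) b)).re =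
        r * (u * f (((fun b => ((X b : lieSU (Fin N)) : Matrix (Fin N) (Fin N) ℂ)) - HV (QV fun b => ((X b : lieSU (Fin N)) : Matrix (Fin N) (Fin N) ℂ))) ⟨b.src.shift κ, b.dir⟩ - ((fun b => ((X b : lieSU (Fin N)) : Matrix (Fin N) (Fin N) ℂ)) - HV (QV fun b => ((X b : lieSU (Fin N)) : Matrix (Fin N) (Fin N) ℂ))) b)).re := by
      rw [map_sub, mul_sub, Complex.sub_re, mul_sub]
    rw [hdiff]
    exact mul_le_mul_of_nonneg_left (hf _) (pow_nonneg (Nat.cast_nonneg _) _)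
  · -- row 3: the Δ_a-row at `ξ⁻¹ = Lᵏ` with the near-top multiplier letter
    rw [eta_inv]
    exact (hrow3 f u r hf b hb).trans hq3

end Body

section Record

/-- ★★★ **THE `A₁` LINE AT EVERY ADMISSIBLE FAMILY OF THE RECORD's TORI, WINDOW OF NEAR-TOP CELLS, ALL PORT LETTERS DISCHARGED** — k0-s1-w1's
`exists_letters10On_A1_closed_of_adm22_T4` with `∀ x ∈ Y, D.InOm (K − n − 1) x` and the threshold `L⁸·max{B₀, 1 + (B₀B₃ + 1)·L·C_G}·(C₄·ρ²)` (§1 ∘ P9 `body_of_adm22_T4` ∘ k0-s1-w4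
`gRowsBand_of_adm22_T4`, thresholds merged as in the parent). [cite: Balaban1985Variational, (10) p.279, (150)–(153) p.301, (158)–(159) pp.302–303, (165)–(167) p.304; Balaban1984PropagatorsII, (2.1)–(2.2) p.224, Prop. 2.2 (2.47) p.231, Cor. 2.8 (2.150)–(2.151) p.249] -/
theorem exists_letters10On_A1_closed_of_adm22_T4_nearTop (F : T4Family) :
    ∃ (Mh₀ R₀ : ℕ) (B₀ δ₀ B₃ CG : ℝ), 0 < δ₀ ∧ 0 < B₃ ∧ 0 ≤ CG ∧
    ∀ (n K : ℕ) (_ : 1 ≤ K - n) (_ : K - n + 1 ≤ F.m + K) {Mh R a' : ℕ} (_ : Mh = F.L ^ a') (_ : Mh₀ ≤ Mh) (_ : R₀ ≤ R)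
      (_ : a' + 3 ≤ F.m + n) (D : Domains (F.P K)) (_ : D.k = K - n) (_ : Adm22 D R (F.L * Mh))
      (w : ℕ → PBond (F.P K) 0 → ℝ) (_ : IsLevWeight (F.P K) (K - n) D w)
      {instDE : DecidableEq (PBond (F.P K) 0)} {instDB : DecidableEq (BondIdx D)}
    {DV GV MV : (PBond (F.P K) 0 → Matrix (Fin N) (Fin N) ℂ) →ₗ[ℂ] (PBond (F.P K) 0 → Matrix (Fin N) (Fin N) ℂ)}
    {QV : (PBond (F.P K) 0 → Matrix (Fin N) (Fin N) ℂ) →ₗ[ℂ] (BondIdx D → Matrix (Fin N) (Fin N) ℂ)}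
    {HV : (BondIdx D → Matrix (Fin N) (Fin N) ℂ) →ₗ[ℂ] (PBond (F.P K) 0 → Matrix (Fin N) (Fin N) ℂ)}
    (hDV : ∀ (A : PBond (F.P K) 0 → Matrix (Fin N) (Fin N) ℂ) (b : PBond (F.P K) 0),
      DV A b = ∑ j, ((WithLp.ofLp (deltaAE D ((F.P K).L ^ (K - n) : ℝ) (fun _ => (1 : ℝ)) (WithLp.toLp 2 (Pi.single j 1))) b : ℝ) : ℂ) • A j)
    (hGV : ∀ (A : PBond (F.P K) 0 → Matrix (Fin N) (Fin N) ℂ) (b : PBond (F.P K) 0),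
      GV A b = ∑ j, ((WithLp.ofLp ((GE D (c := ((F.P K).L : ℝ) ^ (K - n)) (pow_ne_zero _ (Nat.cast_ne_zero.2 (F.P K).L_pos.ne')) (w := fun _ => (1 : ℝ)) (fun _ => one_pos)
        - hOp (GE D (c := ((F.P K).L : ℝ) ^ (K - n)) (pow_ne_zero _ (Nat.cast_ne_zero.2 (F.P K).L_pos.ne')) (w := fun _ => (1 : ℝ)) (fun _ => one_pos)) (QsE D)
            (EE D (c := ((F.P K).L : ℝ) ^ (K - n)) (pow_ne_zero _ (Nat.cast_ne_zero.2 (F.P K).L_pos.ne')) (w := fun _ => (1 : ℝ)) (fun _ => one_pos))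
          ∘ₗ QE D ∘ₗ GE D (c := ((F.P K).L : ℝ) ^ (K - n)) (pow_ne_zero _ (Nat.cast_ne_zero.2 (F.P K).L_pos.ne')) (w := fun _ => (1 : ℝ)) (fun _ => one_pos))
        (WithLp.toLp 2 (Pi.single j 1))) b : ℝ) : ℂ) • A j)
    (hQV : ∀ (A : PBond (F.P K) 0 → Matrix (Fin N) (Fin N) ℂ) (t : BondIdx D),
      QV A t = ∑ j, ((WithLp.ofLp (QE D (WithLp.toLp 2 (Pi.single j 1))) t : ℝ) : ℂ) • A j)
    (hHV : ∀ (B : BondIdx D → Matrix (Fin N) (Fin N) ℂ) (b : PBond (F.P K) 0),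
      HV B b = ∑ t, ((WithLp.ofLp (hOp (GE D (c := ((F.P K).L : ℝ) ^ (K - n)) (pow_ne_zero _ (Nat.cast_ne_zero.2 (F.P K).L_pos.ne')) (w := fun _ => (1 : ℝ)) (fun _ => one_pos))
        (QsE D) (EE D (c := ((F.P K).L : ℝ) ^ (K - n)) (pow_ne_zero _ (Nat.cast_ne_zero.2 (F.P K).L_pos.ne')) (w := fun _ => (1 : ℝ)) (fun _ => one_pos))
        (WithLp.toLp 2 (Pi.single t 1))) b : ℝ) : ℂ) • B t)
    (hMV : ∀ (A : PBond (F.P K) 0 → Matrix (Fin N) (Fin N) ℂ) (b : PBond (F.P K) 0),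
      MV A b = ∑ j, ((WithLp.ofLp ((QsE D
          ∘ₗ EE D (c := ((F.P K).L : ℝ) ^ (K - n)) (pow_ne_zero _ (Nat.cast_ne_zero.2 (F.P K).L_pos.ne')) (w := fun _ => (1 : ℝ)) (fun _ => one_pos)
          ∘ₗ QE D ∘ₗ GE D (c := ((F.P K).L : ℝ) ^ (K - n)) (pow_ne_zero _ (Nat.cast_ne_zero.2 (F.P K).L_pos.ne')) (w := fun _ => (1 : ℝ)) (fun _ => one_pos))
        (WithLp.toLp 2 (Pi.single j 1))) b : ℝ) : ℂ) • A j)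
    (W : (PBond (F.P K) 0 → Matrix (Fin N) (Fin N) ℂ) → (PBond (F.P K) 0 → Matrix (Fin N) (Fin N) ℂ)) {C₄ a₃ ρ : ℝ}
    (hWq : ∀ (Y : PBond (F.P K) 0 → Matrix (Fin N) (Fin N) ℂ) (r : ℝ), r < a₃ → (∀ b, w 1 b * ‖Y b‖ ≤ r) →
      (∀ (b : PBond (F.P K) 0) (ν : Fin 4), w 2 b * (F.L : ℝ) ^ (K - n) * ‖Y ⟨b.src.shift ν, b.dir⟩ - Y b‖ ≤ r) →
        ∀ b, w 3 b * ‖W Y b‖ ≤ C₄ * r ^ 2)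
    (X : PBond (F.P K) 0 → lieSU (Fin N))
    (hWA : ∀ j, (W (fun b => ((X b : lieSU (Fin N)) : Matrix (Fin N) (Fin N) ℂ)) j)ᴴ = -(W (fun b => ((X b : lieSU (Fin N)) : Matrix (Fin N) (Fin N) ℂ)) j))
    (hWtr : ∀ j, (W (fun b => ((X b : lieSU (Fin N)) : Matrix (Fin N) (Fin N) ℂ)) j).trace = 0)
    (h128 : ∀ δ : PBond (F.P K) 0 → lieSU (Fin N), QV (fun j => ((δ j : lieSU (Fin N)) : Matrix (Fin N) (Fin N) ℂ)) = 0 →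
      ∑ j, (((δ j : lieSU (Fin N)) : Matrix (Fin N) (Fin N) ℂ)ᴴ *
        (DV (fun b => ((X b : lieSU (Fin N)) : Matrix (Fin N) (Fin N) ℂ)) j + W (fun b => ((X b : lieSU (Fin N)) : Matrix (Fin N) (Fin N) ℂ)) j)).trace.re = 0)
    (hρ : ρ < a₃) (h1 : ∀ b, w 1 b * ‖((X b : lieSU (Fin N)) : Matrix (Fin N) (Fin N) ℂ)‖ ≤ ρ)
    (h2 : ∀ (b : PBond (F.P K) 0) (ν : Fin 4),
      w 2 b * (F.L : ℝ) ^ (K - n) * ‖((X ⟨b.src.shift ν, b.dir⟩ : lieSU (Fin N)) : Matrix (Fin N) (Fin N) ℂ) - ((X b : lieSU (Fin N)) : Matrix (Fin N) (Fin N) ℂ)‖ ≤ ρ)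
    (hslice : ∀ φ : Matrix (Fin N) (Fin N) ℂ →L[ℂ] ℂ,
      RE D (((F.P K).L : ℝ) ^ (K - n)) (dsE (((F.P K).L : ℝ) ^ (K - n)) (WithLp.toLp 2 (fun b => (φ ((X b : lieSU (Fin N)) : Matrix (Fin N) (Fin N) ℂ)).re))) = 0)
      {Y : Set (Site (F.P K) 0)} (_ : ∀ x ∈ Y, D.InOm (K - n - 1) x) {t : ℝ}
      (_ : (F.L : ℝ) ^ 8 * (max B₀ (1 + (B₀ * B₃ + 1) * (F.L : ℝ) * CG) * (C₄ * ρ ^ 2)) < t),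
      Letters10On Y ((F.P K).eta (K - n)) t ((fun b => ((X b : lieSU (Fin N)) : Matrix (Fin N) (Fin N) ℂ)) - HV (QV fun b => ((X b : lieSU (Fin N)) : Matrix (Fin N) (Fin N) ℂ))) := by
  obtain ⟨Mh₀, R₀, B₀, δ₀, B₃, hδ₀, hB₃, hbody⟩ := body_of_adm22_T4 F
  obtain ⟨Mh₀', R₀', CG, hCG, hG⟩ := gRowsBand_of_adm22_T4 F
  refine ⟨max Mh₀ Mh₀', max (max R₀ R₀') 2, B₀, δ₀, B₃, CG, hδ₀, hB₃, hCG, ?_⟩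
  intro n K hk1 hk' Mh R a' hMha hMh hR hsize D hDk hAdm w hw instDE instDB DV GV MV QV HV hDV hGV hQV hHV hMV
    W C₄ a₃ ρ hWq X hWA hWtr h128 hρ h1 h2 hslice Y hY t ht
  have hMh₁ : Mh₀ ≤ Mh := le_trans (le_max_left _ _) hMh
  have hMh₂ : Mh₀' ≤ Mh := le_trans (le_max_right _ _) hMh
  have hR₁ : R₀ ≤ R := le_trans (le_trans (le_max_left _ _) (le_max_left _ _)) hR
  have hR₂ : R₀' ≤ R := le_trans (le_trans (le_max_right _ _) (le_max_left _ _)) hR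
  have hR2 : 2 ≤ R := le_trans (le_max_right _ _) hR
  -- `2L ≤ R·(L·M_h)` from `R ≥ 2`, `M_h = L^{a′} ≥ 1` (k0-s1-w4's lines)
  have hMh1 : 1 ≤ Mh := by rw [hMha]; exact Nat.one_le_pow _ _ (F.P K).L_pos
  have hRM : 2 * (F.P K).L ≤ R * (F.L * Mh) :=
    calc 2 * (F.P K).L ≤ R * F.L := Nat.mul_le_mul_right _ hR2
      _ = R * (F.L * 1) := by rw [mul_one]
      _ ≤ R * (F.L * Mh) := Nat.mul_le_mul_left _ (Nat.mul_le_mul_left _ hMh1)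
  obtain ⟨aw, haw, G, hGW, hGsup, -, hband⟩ := hG n K hk1 hMha hMh₂ hR₂ hsize D hDk hAdm w hw
  exact letters10On_A1_of_bodyAt_adm22_nearTop F K (K - n) D hDk hk1 hw (hbody n K hk1 hk' hMha hMh₁ hR₁ hsize D hDk hAdm w hw) hδ₀.le hB₃.le hAdm hRM haw hGW hCG
    hGsup hband hDV hGV hQV hHV hMV W hWq X hWA hWtr h128 hρ h1 h2 hslice hY ht

/-- ★★★ **THE A₁ LINE FROM THE ♭ (127) SOCKET, END TO END AT THE RECORD's FAMILIES, WINDOW OF NEAR-TOP CELLS** — k0-s1-w1's `exists_letters10On_A1_of_flatSocket_T4` (p645691) with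
`∀ x ∈ Y, D.InOm (K − n − 1) x` and the `L⁸` threshold; proof VERBATIM over §2. [cite: Balaban1985Variational, (127)–(128) p.297, (150)–(153) p.301, (157)–(159) pp.302–303, (165) p.304; Balaban1984PropagatorsII, (2.1)–(2.2) p.224; Balaban1988Convergent, (2.16) p.257] -/
theorem exists_letters10On_A1_of_flatSocket_T4_nearTop (F : T4Family) :
    ∃ (Mh₀ R₀ : ℕ) (B₀ δ₀ B₃ CG ε C₄ : ℝ), 0 < δ₀ ∧ 0 < B₃ ∧ 0 ≤ CG ∧ 0 < ε ∧ 0 ≤ C₄ ∧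
    ∀ (n K : ℕ) (_ : 1 ≤ K - n) (_ : K - n + 1 ≤ F.m + K) {Mh R a' : ℕ} (_ : Mh = F.L ^ a') (_ : Mh₀ ≤ Mh) (_ : R₀ ≤ R)
      (_ : a' + 3 ≤ F.m + n) (D : Domains (F.P K)) (_ : D.k = K - n) (_ : Adm22 D R (F.L * Mh))
      (w : ℕ → PBond (F.P K) 0 → ℝ) (_ : IsLevWeight (F.P K) (K - n) D w),
    -- Sect. F's ♭ chart at this family, RE-EXPORTED with its defining rows
    ∃ (H : (BondIdx D → Matrix (Fin N) (Fin N) ℂ) →ₗ[ℂ] (PBond (F.P K) 0 → Matrix (Fin N) (Fin N) ℂ))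
      (Dsel : (PBond (F.P K) 0 → Matrix (Fin N) (Fin N) ℂ) → (BondIdx D → Matrix (Fin N) (Fin N) ℂ)),
      (∀ (X : BondIdx D → Matrix (Fin N) (Fin N) ℂ) (b : PBond (F.P K) 0), H X b =
        ∑ t, (((((F.P K).L : ℝ) ^ (t.1.1 : ℕ) * ((((F.P K).L : ℝ))⁻¹) ^ (K - n))⁻¹ * flatH (F.P K) (K - n) D (Pi.single t 1) b : ℝ) : ℂ) • X t) ∧
      (∀ A' : PBond (F.P K) 0 → Matrix (Fin N) (Fin N) ℂ, (∀ b, w 1 b * ‖A' b‖ < ε) →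
        ∀ ρ' : ℝ, 0 ≤ ρ' → (∀ b, w 1 b * ‖A' b‖ ≤ ρ') → ∀ i : BondIdx D, ‖Dsel A' i‖ ≤ C₄ * ρ' ^ 2) ∧
      ContDiffOn ℂ ω Dsel {Y : PBond (F.P K) 0 → Matrix (Fin N) (Fin N) ℂ | ∀ b, w 1 b * ‖Y b‖ < ε} ∧
      (∀ A' : PBond (F.P K) 0 → Matrix (Fin N) (Fin N) ℂ, (∀ b, w 1 b * ‖A' b‖ < ε) →
        chartLogFlat (((((F.P K).L : ℝ))⁻¹) ^ (K - n)) D (A' - H (Dsel A')) - (fderiv ℂ (chartLogFlat (((((F.P K).L : ℝ))⁻¹) ^ (K - n)) D :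
        (PBond (F.P K) 0 → Matrix (Fin N) (Fin N) ℂ) → BondIdx D → Matrix (Fin N) (Fin N) ℂ) 0) (A' - H (Dsel A')) = Dsel A' ∧
        chartLogFlat (((((F.P K).L : ℝ))⁻¹) ^ (K - n)) D (A' - H (Dsel A')) = (fderiv ℂ (chartLogFlat (((((F.P K).L : ℝ))⁻¹) ^ (K - n)) D :
        (PBond (F.P K) 0 → Matrix (Fin N) (Fin N) ℂ) → BondIdx D → Matrix (Fin N) (Fin N) ℂ) 0) A') ∧
      (∀ A' : PBond (F.P K) 0 → Matrix (Fin N) (Fin N) ℂ, (∀ b, w 1 b * ‖A' b‖ < ε) → (∀ b, A' b ∈ herm0 (Fin N)) →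
        (∀ i, Dsel A' i ∈ herm0 (Fin N)) ∧ ∀ b, (A' - H (Dsel A')) b ∈ herm0 (Fin N)) ∧
      -- THE A₁ LINE: p595460's kernel-formula letters; then every small 𝔰𝔲(N)-valued `X` on the slice whose charted point is critical on the record's fibre
      ∀ {instDE : DecidableEq (PBond (F.P K) 0)} {instDB : DecidableEq (BondIdx D)}
    {DV GV MV : (PBond (F.P K) 0 → Matrix (Fin N) (Fin N) ℂ) →ₗ[ℂ] (PBond (F.P K) 0 → Matrix (Fin N) (Fin N) ℂ)}
    {QV : (PBond (F.P K) 0 → Matrix (Fin N) (Fin N) ℂ) →ₗ[ℂ] (BondIdx D → Matrix (Fin N) (Fin N) ℂ)}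
    {HV : (BondIdx D → Matrix (Fin N) (Fin N) ℂ) →ₗ[ℂ] (PBond (F.P K) 0 → Matrix (Fin N) (Fin N) ℂ)}
    (_ : ∀ (A : PBond (F.P K) 0 → Matrix (Fin N) (Fin N) ℂ) (b : PBond (F.P K) 0),
      DV A b = ∑ j, ((WithLp.ofLp (deltaAE D ((F.P K).L ^ (K - n) : ℝ) (fun _ => (1 : ℝ)) (WithLp.toLp 2 (Pi.single j 1))) b : ℝ) : ℂ) • A j)
    (_ : ∀ (A : PBond (F.P K) 0 → Matrix (Fin N) (Fin N) ℂ) (b : PBond (F.P K) 0),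
      GV A b = ∑ j, ((WithLp.ofLp ((GE D (c := ((F.P K).L : ℝ) ^ (K - n)) (pow_ne_zero _ (Nat.cast_ne_zero.2 (F.P K).L_pos.ne')) (w := fun _ => (1 : ℝ)) (fun _ => one_pos)
        - hOp (GE D (c := ((F.P K).L : ℝ) ^ (K - n)) (pow_ne_zero _ (Nat.cast_ne_zero.2 (F.P K).L_pos.ne')) (w := fun _ => (1 : ℝ)) (fun _ => one_pos)) (QsE D)
            (EE D (c := ((F.P K).L : ℝ) ^ (K - n)) (pow_ne_zero _ (Nat.cast_ne_zero.2 (F.P K).L_pos.ne')) (w := fun _ => (1 : ℝ)) (fun _ => one_pos))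
          ∘ₗ QE D ∘ₗ GE D (c := ((F.P K).L : ℝ) ^ (K - n)) (pow_ne_zero _ (Nat.cast_ne_zero.2 (F.P K).L_pos.ne')) (w := fun _ => (1 : ℝ)) (fun _ => one_pos))
        (WithLp.toLp 2 (Pi.single j 1))) b : ℝ) : ℂ) • A j)
    (_ : ∀ (A : PBond (F.P K) 0 → Matrix (Fin N) (Fin N) ℂ) (t : BondIdx D),
      QV A t = ∑ j, ((WithLp.ofLp (QE D (WithLp.toLp 2 (Pi.single j 1))) t : ℝ) : ℂ) • A j)
    (_ : ∀ (B : BondIdx D → Matrix (Fin N) (Fin N) ℂ) (b : PBond (F.P K) 0),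
      HV B b = ∑ t, ((WithLp.ofLp (hOp (GE D (c := ((F.P K).L : ℝ) ^ (K - n)) (pow_ne_zero _ (Nat.cast_ne_zero.2 (F.P K).L_pos.ne')) (w := fun _ => (1 : ℝ)) (fun _ => one_pos))
        (QsE D) (EE D (c := ((F.P K).L : ℝ) ^ (K - n)) (pow_ne_zero _ (Nat.cast_ne_zero.2 (F.P K).L_pos.ne')) (w := fun _ => (1 : ℝ)) (fun _ => one_pos))
        (WithLp.toLp 2 (Pi.single t 1))) b : ℝ) : ℂ) • B t)
    (_ : ∀ (A : PBond (F.P K) 0 → Matrix (Fin N) (Fin N) ℂ) (b : PBond (F.P K) 0),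
      MV A b = ∑ j, ((WithLp.ofLp ((QsE D
          ∘ₗ EE D (c := ((F.P K).L : ℝ) ^ (K - n)) (pow_ne_zero _ (Nat.cast_ne_zero.2 (F.P K).L_pos.ne')) (w := fun _ => (1 : ℝ)) (fun _ => one_pos)
          ∘ₗ QE D ∘ₗ GE D (c := ((F.P K).L : ℝ) ^ (K - n)) (pow_ne_zero _ (Nat.cast_ne_zero.2 (F.P K).L_pos.ne')) (w := fun _ => (1 : ℝ)) (fun _ => one_pos))
        (WithLp.toLp 2 (Pi.single j 1))) b : ℝ) : ℂ) • A j)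
        (X : PBond (F.P K) 0 → lieSU (Fin N)) (ρ' : ℝ) (_ : ρ' < ((((F.P K).L : ℝ)⁻¹) ^ (K - n)) * ε)
        (_ : ∀ b, w 1 b * ‖((X b : lieSU (Fin N)) : Matrix (Fin N) (Fin N) ℂ)‖ ≤ ρ')
        (_ : ∀ (b : PBond (F.P K) 0) (ν : Fin 4),
          w 2 b * (F.L : ℝ) ^ (K - n) * ‖((X ⟨b.src.shift ν, b.dir⟩ : lieSU (Fin N)) : Matrix (Fin N) (Fin N) ℂ) - ((X b : lieSU (Fin N)) : Matrix (Fin N) (Fin N) ℂ)‖ ≤ ρ')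
        (_ : ∀ φ : Matrix (Fin N) (Fin N) ℂ →L[ℂ] ℂ,
          RE D (((F.P K).L : ℝ) ^ (K - n)) (dsE (((F.P K).L : ℝ) ^ (K - n)) (WithLp.toLp 2 (fun b => (φ ((X b : lieSU (Fin N)) : Matrix (Fin N) (Fin N) ℂ)).re))) = 0)
        (𝔹 : DetSet (F.P K)) (_ : ∀ (j : ℕ) (b : PBond (F.P K) j), b ∈ bondsOf (𝔹 j) → j ≤ K - n ∧ D.LamBond j b)
        (U₁ : GaugeField (F.P K) 0 (SU N))
        (_ : ∀ b, ((U₁ b : SU N) : Matrix (Fin N) (Fin N) ℂ) =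
          ((expCfg ((((F.P K).L : ℝ)⁻¹) ^ (K - n))
            ((fun b => (Complex.I * (((((F.P K).L : ℝ)⁻¹) ^ (K - n) : ℝ) : ℂ))⁻¹ • ((X b : lieSU (Fin N)) : Matrix (Fin N) (Fin N) ℂ)) -
              H (Dsel (fun b => (Complex.I * (((((F.P K).L : ℝ)⁻¹) ^ (K - n) : ℝ) : ℂ))⁻¹ • ((X b : lieSU (Fin N)) : Matrix (Fin N) (Fin N) ℂ)))) b :
            (Matrix (Fin N) (Fin N) ℂ)ˣ) : _))
        (_ : IsCritOnFibre F N K 𝔹 (avgFamily (avOfRecord F N K) U₁) U₁)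
        {Y : Set (Site (F.P K) 0)} (_ : ∀ x ∈ Y, D.InOm (K - n - 1) x) {t : ℝ}
        (_ : (F.L : ℝ) ^ 8 * (max B₀ (1 + (B₀ * B₃ + 1) * (F.L : ℝ) * CG) *
          ((2 * (((F.P K).L ^ (K - n) : ℝ) ^ 2 * ((((F.P K).L : ℝ)⁻¹) ^ (K - n)) ^ (F.P K).d * ((((F.P K).L : ℝ)⁻¹) ^ (K - n))⁻¹) *
            ((((F.P K).L : ℝ)⁻¹) ^ (K - n))⁻¹ ^ 2 * C₄) * ρ' ^ 2) ) < t),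
        Letters10On Y ((F.P K).eta (K - n)) t
          ((fun b => ((X b : lieSU (Fin N)) : Matrix (Fin N) (Fin N) ℂ)) - HV (QV fun b => ((X b : lieSU (Fin N)) : Matrix (Fin N) (Fin N) ℂ))) := by
  obtain ⟨Mh₀, R₀, B₀, δ₀, B₃, CG, hδ₀, hB₃, hCG, hA1⟩ := exists_letters10On_A1_closed_of_adm22_T4_nearTop (N := N) F
  obtain ⟨Mh₀', R₀', ε, C₄, hε, hC₄, hS⟩ := exists_sectF_W_flatScaled_atRecord_socket_A1rows N F
  refine ⟨max Mh₀ Mh₀', max R₀ R₀', B₀, δ₀, B₃, CG, ε, C₄, hδ₀, hB₃, hCG, hε, hC₄, ?_⟩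
  intro n K h1K hKm Mh R a' hMha hMh₀ hR₀ ha' D hDk hAdm w hw
  obtain ⟨τ, ρ, BE, B, hc, hwa, MVf, H, Dsel, Qt, Ht, Dt, e, WS, hntr, hρ, hBE, hB, hMVf, hH, h55, hcd, hfix, hherm, hQt, hHt, hDt, he, h157, hdiff, h158,
    hsock, hWq, hWAtr⟩ := hS n K h1K hKm hMha (le_trans (le_max_right _ _) hMh₀) (le_trans (le_max_right _ _) hR₀) ha' D hDk hAdm hw
  refine ⟨H, Dsel, hH, h55, hcd, hfix, hherm, ?_⟩
  intro instDE instDB DV GV MV QV HV hDV hGV hQV hHV hMV X ρ' hρ' hX1 hX2 hslice 𝔹 h𝔹 U₁ hU₁ hcrit Y hY t ht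
  -- abbreviations
  set η : ℝ := (((F.P K).L : ℝ)⁻¹) ^ (K - n) with hηdef
  set c : ℝ := ((F.P K).L ^ (K - n) : ℝ) with hcdef
  have hL0 : (0 : ℝ) < (F.P K).L := Nat.cast_pos.2 (F.P K).L_pos
  have hη0 : 0 < η := by rw [hηdef]; positivity
  have hηne : η ≠ 0 := hη0.ne'
  have hcne : c ≠ 0 := by rw [hcdef]; positivity
  -- the Hermitian letter `A′₁ := (iη)⁻¹•⇑X`: herm0, in the two-size window
  set A₁ : PBond (F.P K) 0 → Matrix (Fin N) (Fin N) ℂ := fun b => (Complex.I * (η : ℂ))⁻¹ • ((X b : lieSU (Fin N)) : Matrix (Fin N) (Fin N) ℂ) with hA₁def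
  have hA₁h : ∀ b, A₁ b ∈ herm0 (Fin N) := fun b => inv_I_eta_smul_mem_herm0 (X b).2
  obtain ⟨hA₁1, hA₁2⟩ := hermLetter_rows_lt (P := F.P K) (Λ := (F.L : ℝ) ^ (K - n)) hη0 w X hρ' hX1 hX2
  -- the tangent letter `X₁ := X` in S1's carrier
  let X₁ : TangentBondSU (F.P K) 0 N := WithLp.toLp 2 X
  have hX₁ : ∀ b, ((X₁ b : lieSU (Fin N)) : Matrix (Fin N) (Fin N) ℂ) = (Complex.I * (η : ℂ)) • A₁ b := by
    intro b
    show ((X b : lieSU (Fin N)) : Matrix (Fin N) (Fin N) ℂ) = (Complex.I * (η : ℂ)) • ((Complex.I * (η : ℂ))⁻¹ • ((X b : lieSU (Fin N)) : Matrix (Fin N) (Fin N) ℂ))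
    rw [smul_smul, mul_inv_cancel₀ (mul_ne_zero Complex.I_ne_zero (Complex.ofReal_ne_zero.2 hηne)), one_smul]
  -- the fourth row `h128` from the socket (p643165), for the current `W_A₁ ⇑X = κ•(W_S A′₁)♮`
  have h128 := h128_of_socket127_flat (N := N) D hηne hcne (fun _ => (1 : ℝ)) hDV hQV X₁ hslice (BE (WS A₁))
    (fun j => (Complex.I * (c : ℂ) ^ 2 * (η : ℂ) ^ (F.P K).d * ((η : ℂ))⁻¹) • (WS A₁ j - (((N : ℂ))⁻¹ * (WS A₁ j).trace) • (1 : Matrix (Fin N) (Fin N) ℂ)))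
    (re_trace_pairing_rescaled_current_traceless η c hηne τ hntr BE hBE (WS A₁))
    (fun δ δX hδh hδQ hδX => hsock A₁ δ hA₁1 hA₁2 hA₁h hδh hδQ 𝔹 h𝔹 U₁ hU₁ hcrit X₁ δX hX₁ hδX)
  -- the A₁ line (p612312) with its four `W`-rows discharged
  exact hA1 n K h1K hKm hMha (le_trans (le_max_left _ _) hMh₀) (le_trans (le_max_left _ _) hR₀) ha' D hDk hAdm w hw hDV hGV hQV hHV hMV
    (fun Y b => (Complex.I * (c : ℂ) ^ 2 * (η : ℂ) ^ (F.P K).d * ((η : ℂ))⁻¹) •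
      (WS (fun b' => (Complex.I * (η : ℂ))⁻¹ • Y b') b - (((N : ℂ))⁻¹ * (WS (fun b' => (Complex.I * (η : ℂ))⁻¹ • Y b') b).trace) • (1 : Matrix (Fin N) (Fin N) ℂ)))
    hWq X (hWAtr X ρ' hρ' hX1 hX2).1 (hWAtr X ρ' hρ' hX1 hX2).2 h128 hρ' hX1 hX2 hslice hY ht

end Record

end Summit.QuantumFields.YangMills.BalabanUVNodes.N07Letters10OnA1NearTop

end
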